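import Summits.BirchSwinnertonDyer.Rank1Residual.Additive.GordChiBranchKatoComponent
import Literature.NumberTheory.EllipticCurves.Wuthrich2014.SurjectiveDivisibilityCyclotomicPrimeHalf
import HarnessLib

/-!
# The LOWER half at CLASS LEVEL, typed at the IWASAWA (Λ) level: the Skinner–Urban containment on
# the QUADRATIC branch `ω^{(p−1)/2}` of the semistable twist `E♭` over `ℚ(μ_{p^∞})` — OUR
# CONJECTURE (`@[conjecture] def`, nothing asserted) + its `T = 0` consequences at the `E♭`-level
# (cell `b2b-bsdres`, team n1011, seat p10, row T-c2 (i))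

HONEST FRAMING (cell `b2b-bsdres`, run/shared/lean/b2b/bsd-rank1-residual/, verbatim in every
file): the goal of the cell is to DELETE the COMBINATION-SHAPED residual classes of the
Birch–Swinnerton-Dyer formula for ALL analytic-rank `≤ 1` elliptic curves over `ℚ` — "full BSD
formula for every rank `≤ 1` curve in class `C`" assembled STRICTLY from published theorems — so
that the rank-`≤ 1` remainder becomes exactly the CONSTRUCTION-SHAPED classes, which are TYPED
(missing-input `Prop`s), NOT attempted. This is not "finishing BSD". Team n1011 (RESIDUAL-MAP §I
N10 / N11): prove what is provable now; shrink each hard class to its core with data; no claim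
beyond stated classes. Research route on the CONSTRUCTION-SHAPED items N10/N11 (X3 ∪ X4, `r = 0`,
the LOWER half `ord_p #Ш_an ≤ ord_p #Ш` at an additive prime); N10/N11 stay CONSTRUCTION; nothing is
booked; no label moves. ONE `@[conjecture] def` (OUR conjecture = a typed missing input, NOT a
Literature fact, NOT in print — see below), its unfolding lemma, and theorems; no named fact minted.

## What and why (PLAN.md v1.1 §1.2, §2 route (c) T-c2; RESIDUAL-MAP §I N10/N11)

On the semistable-twist locus of X4 (`E = E♭ ⊗ χ_{p*}`, `E♭ = V` good ordinary — Kodaira `I₀*`,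
sub-cell `SubGordTwo` — or multiplicative — `I_n*`, sub-cell `SubM` — at the odd prime `p`,
`p* = (−1)^{(p−1)/2} p`) the classical prime-to-`p` descent identifies `X(E/ℚ_∞)` with the
`ω^{(p−1)/2}`-eigencomponent `e_m X(E♭/ℚ(μ_{p^∞}))`, `m = (p−1)/2` (Greenberg LNM 1716 §5; in the
kernel: additive-p1's `TwistDescent`, additive-p2's `ChiEigenPrimeToPDescent*`,
`SelmerDualData.exists_chiEigenInCyclotomic`). The EULER-SYSTEM direction of the Iwasawa main
conjecture on that component — `char_{Λ(Γ)} e_m X(E♭/ℚ(μ_{p^∞})) ∋ u·ϖ·L_p(E♭, ω^m, T)`, i.e.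
`char ∣ ϖ·L_branch` — is IN PRINT under big `p`-adic image (Kato, Astérisque 295 (2004) Thm. 17.4 (3);
Wuthrich, Doc. Math. 19 (2014) Thm. 16 for semistable `p`) and typed as the tree facts
`Wuthrich2014.kato_halfEigenCharIdeal_dvd_cyclotomicPrime_of_surjective` /
`Kato2004.charIdeal_dvd_padicLFunctionBranch_component_of_surjective`; it yields the UPPER half of
`BSD(E,p)` in rank `0` (additive-p2 `ClassX4Gord.missingUpperBoundAt_rankZero_of_katoComponent…`,
additive-p1 `ClassX4M.…`). The LOWER half of N10/N11 on this locus is EXACTLY the OPPOSITE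
containment `ϖ·L_branch ∣ char` ("`Ch ⊆ (𝓛)`", the direction Skinner–Urban prove) ON THE SAME
COMPONENT — and it is NOT IN PRINT at any such pair:
* Skinner–Urban, Invent. Math. 195 (2014), Thm. 3.6.4 (tree fact
  `SkinnerUrban2014.thm1_charIdeal_eq_padicLFunction_rational`, registry A143) is printed for the
  TRIVIAL component only — hypotheses "`χ = 1`, `k ≡ 2 (mod p−1)`, (irr), (ram): `q ‖ N`, `p ∤ N`"
  and "Remarks on the hypotheses (i)" (p. 43); Cor. 3.3.20 / Thm. 3.6.13 reach the WILD (`p`-power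
  conductor) twists of that component only (lit-su SU2014-TYPING.md; harvest-2 E65 (A));
* X. Wan, Forum Math. Sigma 3 (2015) e18 (Hilbert modular forms) needs "`p` unramified in `F`" —
  base change to `ℚ(√p*)` excluded (additive-p4 REPAIR-CENSUS gen 14; harvest-2 E65 (A));
* the lead's OBSTRUCTION OF RECORD (PLAN.md §1.2): no twist moves the quadratic branch of an
  ordinary family to the trivial branch of an ORDINARY family — `f ⊗ χ_{p*}` (`χ_f = 1`) has
  `π_p = Ind(μ₁χ, μ₂χ)` with both characters ramified, never `p`-ordinary; so "SU ∘ twist" is empty.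
  (Announced neighbour, OPEN: Burungale–Skinner–Tian–Wan arXiv:2409.01350 Thm. 1.21 (c),
  `g ⊗ χ_K`, `p ∣ d_K`, `p ∤ 6N_g`.)
So the statement is typed HERE as OUR CONJECTURE, in the exact binder shape of the tree's
Euler-system fact `Wuthrich2014.kato_halfEigenCharIdeal_dvd_cyclotomicPrime_of_surjective`
(semistable `V` at `p`: good ordinary / split / non-split multiplicative, with the matching branch
series `B`; `K = ℚ(√p*) ⊂ F = ℚ(ζ_p)`; the eigen-`Λ`-dual datum in the cell's vocabulary
`ChiEigenSelmerInDualData V K κ (galRange F) γ` of additive-p2, which is where the kernel descent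
lands) with the CONCLUSION REVERSED — every `g ∈ char_Λ` is a `Λ`-multiple of `ϖ·B` in `ℚ_p⟦T⟧` —
and WITHOUT the image hypothesis (a lower-bound statement carries none; consumers that want the
EQUALITY of ideals add the tree fact and its tower hypothesis, `QuadraticBranchLower.exists_generator_of_lower_of_upper`).

* §1 `QuadraticBranchLowerDivisibilityAt V p` — the `@[conjecture] def` (predicate on the
  SEMISTABLE curve `V = E♭` and `p`; its universal closure over the X4-relevant `V` — `V[p]`
  irreducible — is the conjecture; NOTHING asserted; for reducible `V[p]` (X3 side) the integral
  statement is lattice-sensitive and is NOT the object — see team row T-c2x3).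
* §2 `T = 0` at the `E♭`-level, good ordinary `V` (both parities): under the conjecture every
  `g ∈ char_Λ` has `g(0) ∈ ϖ·(∑_{a mod p} (a/p)[a/p]^±_f)·ℤ_p` (Mazur–Tate–Teitelbaum §I.14:
  `B(0) = α⁻¹·∑ (a/p)[a/p]^±`, tree `constantCoeff_padicLFunctionBranch_half` /
  `constantCoeff_padicLFunctionMinusBranch_half`; `α ∈ ℤ_p^×`).
* §3 EQUALITY from both halves: the conjecture ∧ the Kato–Wuthrich fact (tower image) ⟹ `ϖ·B`
  GENERATES `char_Λ e_m X` in `ℚ_p⟦T⟧` (`QuadraticBranchLower.exists_generator_of_lower_of_upper`).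
* sibling file `QuadraticBranchLowerDescent.lean`: the DESCENDED `W`-level forms of seat p07
  (`ChiBranchLowerInput.lean`) — `ChiBranchLowerDivisibilityAt W p` (Λ-level) and
  `ChiBranchLowerLeadingTerm[Odd]At W p` (`T = 0`, potentially good `W`) — from the conjecture by
  additive-p2's kernel descent `SelmerDualData.exists_chiEigenInCyclotomic`.

Downstream (NOT in this file; OWNERS.md N10 ruling, one Miller-currency consumer per locus): from
the sibling's descended forms, seat p07's `cycLowerLeadingTermAt_of_chiBranchLower[Odd]` (`ChiBranchLowerTransport.lean`:
Birch + Pal) gives the cyclotomic `T = 0` input `CycLowerLeadingTermAt W p`, and the team's N10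
consumers (`N10LowerHalfIwasawa.lean`, `CycLeadingTermDvd.lean`: the EXACT algebraic leading term,
Delbourgo 1998 Thm. 3 / Prop. 4, Delbourgo 2002) give `Typed.MissingLowerBoundAt W p` — the
mirror of additive-p2's `X4RankZeroTwist{Odd,Even}` chain with both inequalities reversed; the
end-to-end composition `ClassX4Gord.missingLowerBoundAt_rankZero_of_quadraticBranchLower…` is the
sequel (T-c2 (iii)).

References: Skinner–Urban 2014 [SkinnerUrban2014] Thm. 3.6.4, Cor. 3.3.20, Remarks (i) p. 43;
Kato 2004 [Kato2004Asterisque] Thm. 17.4 (3); Wuthrich 2014 [Wuthrich2014] Thm. 16, §3;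
Mazur–Tate–Teitelbaum 1986 [MazurTateTeitelbaum1986Invent] §I.13–I.14; Greenberg 1999
[GreenbergLNM1716] §5; Delbourgo 1998 [Delbourgo1998] Main Conjecture p. 151 (the `T = 0` shadow);
Wan 2015 [Wan2015HilbertIMC]; BSTW arXiv:2409.01350 (announced).
-/

noncomputable section

open scoped Classical MatrixGroups ModularForm

open CongruenceSubgroup WeierstrassCurve Literature.NumberTheory.EllipticCurves
  Literature.NumberTheory.EllipticCurves.ModularForms
  Literature.NumberTheory.EllipticCurves.Rank1Residual
  Literature.NumberTheory.GaloisRepresentations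

namespace Summit.BirchSwinnertonDyer.Rank1Residual.Additive

/-! ### §1 The conjecture, typed (Λ-level, `E♭` over `ℚ(μ_{p^∞})`, quadratic component) -/

/-- **OUR CONJECTURE (typed missing input; NOT in print; nothing asserted): the Skinner–Urban
containment `ϖ·L_p(E♭, ω^{(p−1)/2}, T) ∣ char_{Λ(Γ)} e_{(p−1)/2} X(E♭/ℚ(μ_{p^∞}))`** for a globally
minimal `V = E♭` SEMISTABLE at the odd prime `p`. Binders = those of the tree's Euler-system fact
`Wuthrich2014.kato_halfEigenCharIdeal_dvd_cyclotomicPrime_of_surjective` WITHOUT the image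
hypothesis: `K` the quadratic field with `θ² = p*`, `F = ℚ(ζ_p)` (`IsCyclotomicExtension {p} ℚ F`),
`κ` the cyclotomic `ℤ_p`-extension of `ℚ` with topological generator `γ ∈ Gal(ℚ̄/K) ∩ Gal(ℚ̄/F)`
matching the cyclotomic variable, `f` the newform of `V`, `B` the branch series of the reduction
type (`V` good ordinary: `L_p(f, α, ω^m, T)` on the `±`-symbols of the parity of `m = (p−1)/2`,
`α = unitRoot V p`; split / non-split multiplicative: the `a_p = ±1` series), `D` a `Λ`-dual datum
of the `χ_K`-eigenspace `Sel_{p^∞}(E♭/F·K·ℚ_∞)^{(χ_K)} = e_m Sel_{p^∞}(E♭/ℚ(μ_{p^∞}))`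
(`ChiEigenSelmerInDualData V K κ (galRange F) γ`), `ϖ` the period ratio of that parity
(`ϖ·Ω_V = Ω⁺_f`, resp. `ϖ·|Ω⁻(V)| = Ω⁻_f`). CONCLUSION: every `g ∈ char_Λ D.X` is `h·(ϖ·B)` in
`ℚ_p⟦T⟧` for some `h ∈ Λ` — the containment "`Ch ⊆ (𝓛)`" of Skinner–Urban 2014 Thm. 3.6.4 /
Cor. 3.6.3, printed for the TRIVIAL component `ω^0` under `p ∤ N` only, here on the component
`ω^{(p−1)/2}`. A predicate on `(V, p)`; the cell CONJECTURES it for `V[p]` irreducible (the X4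
semistable-twist locus); for reducible `V[p]` it is not the intended object (lattice / `μ`).
[cite: SkinnerUrban2014, Thm. 3.6.4 and Remarks (i) (p. 43) (shape only; nothing asserted)]
[cite: Kato2004Asterisque, Thm. 17.4 (3) (p. 273) (binder shape only)] [cite: Wuthrich2014, §3 (p. 390) (shape only)] -/
@[conjecture] def QuadraticBranchLowerDivisibilityAt (V : WeierstrassCurve ℚ) [V.IsElliptic]
    [V.IsGloballyMinimal] (p : ℕ) [Fact p.Prime] : Prop :=
  ∀ (K : Type) [Field K] [NumberField K] [(galRange (K := ℚ) K).Normal]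
    (F : Type) [Field F] [NumberField F] [IsCyclotomicExtension {p} ℚ F]
    [(galRange (K := ℚ) F).Normal]
    {κ : ZpExtension ℚ p} {γ : Field.absoluteGaloisGroup ℚ} {N : ℕ} [NeZero N]
    {f : CuspForm (Gamma0 N) 2} (B : PowerSeries ℚ_[p]),
    p ≠ 2 → Module.finrank ℚ K = 2 →
    (∃ θ : K, θ ^ 2 = algebraMap ℚ K ((-1) ^ (p / 2) * p)) →
    ((IsOrdinaryAt V p ∧
        B = if Even (p / 2) then padicLFunctionBranch f ((unitRoot V p : ℤ_[p]) : ℚ_[p]) (p / 2)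
          else padicLFunctionMinusBranch f ((unitRoot V p : ℤ_[p]) : ℚ_[p]) (p / 2)) ∨
      (V.HasSplitMultiplicativeReductionAtPrime p ∧
        B = if Even (p / 2) then padicLFunctionPlusBranchMult f (1 : ℚ_[p]) (p / 2)
          else padicLFunctionMinusBranchMult f (1 : ℚ_[p]) (p / 2)) ∨
      (V.HasMultiplicativeReductionAtPrime p ∧ ¬ V.HasSplitMultiplicativeReductionAtPrime p ∧
        B = if Even (p / 2) then padicLFunctionPlusBranchMult f (-1 : ℚ_[p]) (p / 2)
          else padicLFunctionMinusBranchMult f (-1 : ℚ_[p]) (p / 2))) →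
    κ.IsCyclotomic → κ.IsTopGenerator γ → IsCyclotomicVariable p γ →
    γ ∈ galRange (K := ℚ) K → γ ∈ galRange (K := ℚ) F → IsNewformOf V f →
    ∀ (D : ChiEigenSelmerInDualData V K κ (galRange (K := ℚ) F) γ) (ϖ : ℚ),
      (if Even (p / 2) then (ϖ : ℝ) * V.realPeriodRat = plusPeriod f
        else (ϖ : ℝ) * V.imaginaryPeriodRat = minusPeriod f) →
      ∀ g ∈ Literature.NumberTheory.EllipticCurves.Module.charIdeal (IwasawaAlgebra p) D.X,
        ∃ h : IwasawaAlgebra p,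
          iwasawaToPowerSeries p g =
            iwasawaToPowerSeries p h * (PowerSeries.C (ϖ : ℚ_[p]) * B)

/-- Unfolding lemma (to apply the predicate as a function). [folklore] -/
theorem quadraticBranchLowerDivisibilityAt_iff (V : WeierstrassCurve ℚ) [V.IsElliptic]
    [V.IsGloballyMinimal] (p : ℕ) [Fact p.Prime] :
    QuadraticBranchLowerDivisibilityAt V p ↔
      ∀ (K : Type) [Field K] [NumberField K] [(galRange (K := ℚ) K).Normal]
        (F : Type) [Field F] [NumberField F] [IsCyclotomicExtension {p} ℚ F]
        [(galRange (K := ℚ) F).Normal]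
        {κ : ZpExtension ℚ p} {γ : Field.absoluteGaloisGroup ℚ} {N : ℕ} [NeZero N]
        {f : CuspForm (Gamma0 N) 2} (B : PowerSeries ℚ_[p]),
        p ≠ 2 → Module.finrank ℚ K = 2 →
        (∃ θ : K, θ ^ 2 = algebraMap ℚ K ((-1) ^ (p / 2) * p)) →
        ((IsOrdinaryAt V p ∧
            B = if Even (p / 2) then padicLFunctionBranch f ((unitRoot V p : ℤ_[p]) : ℚ_[p]) (p / 2)
              else padicLFunctionMinusBranch f ((unitRoot V p : ℤ_[p]) : ℚ_[p]) (p / 2)) ∨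
          (V.HasSplitMultiplicativeReductionAtPrime p ∧
            B = if Even (p / 2) then padicLFunctionPlusBranchMult f (1 : ℚ_[p]) (p / 2)
              else padicLFunctionMinusBranchMult f (1 : ℚ_[p]) (p / 2)) ∨
          (V.HasMultiplicativeReductionAtPrime p ∧ ¬ V.HasSplitMultiplicativeReductionAtPrime p ∧
            B = if Even (p / 2) then padicLFunctionPlusBranchMult f (-1 : ℚ_[p]) (p / 2)
              else padicLFunctionMinusBranchMult f (-1 : ℚ_[p]) (p / 2))) →
        κ.IsCyclotomic → κ.IsTopGenerator γ → IsCyclotomicVariable p γ →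
        γ ∈ galRange (K := ℚ) K → γ ∈ galRange (K := ℚ) F → IsNewformOf V f →
        ∀ (D : ChiEigenSelmerInDualData V K κ (galRange (K := ℚ) F) γ) (ϖ : ℚ),
          (if Even (p / 2) then (ϖ : ℝ) * V.realPeriodRat = plusPeriod f
            else (ϖ : ℝ) * V.imaginaryPeriodRat = minusPeriod f) →
          ∀ g ∈ Literature.NumberTheory.EllipticCurves.Module.charIdeal (IwasawaAlgebra p) D.X,
            ∃ h : IwasawaAlgebra p,
              iwasawaToPowerSeries p g =
                iwasawaToPowerSeries p h * (PowerSeries.C (ϖ : ℚ_[p]) * B) :=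
  Iff.rfl

/-! ### §2 `T = 0` at the `E♭`-level, good ordinary `V` -/

section ConstantTerm

variable {V : WeierstrassCurve ℚ} [V.IsElliptic] [V.IsGloballyMinimal] {p : ℕ} [hp : Fact p.Prime]

/-- **`T = 0` under the conjecture, good ordinary `E♭`, EVEN branch (`p ≡ 1 (mod 4)`):** every
`g ∈ char_Λ e_{(p−1)/2}X` has constant term `g(0) = h · ϖ · ∑_{a mod p} (a/p)[a/p]⁺_f` with
`h ∈ ℤ_p` — the value of the branch at `T = 0` is `α⁻¹·∑ (a/p)[a/p]⁺` (Mazur–Tate–Teitelbaum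
§I.14; tree `constantCoeff_padicLFunctionBranch_half`), `α ∈ ℤ_p^×` absorbed in `h`. This is the
`E♭`-level `T = 0` shadow of the conjecture (Delbourgo 1998's Main Conjecture p. 151 at `T = 0`, in
the lower direction). [cite: MazurTateTeitelbaum1986Invent, §I.13–I.14]
[cite: Delbourgo1998, Main Conjecture (p. 151) (shape only; nothing asserted)] -/
theorem QuadraticBranchLower.constantCoeff_of_goodOrd_even
    (hc : QuadraticBranchLowerDivisibilityAt V p)
    (K : Type) [Field K] [NumberField K] [(galRange (K := ℚ) K).Normal]
    (F : Type) [Field F] [NumberField F] [IsCyclotomicExtension {p} ℚ F]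
    [(galRange (K := ℚ) F).Normal]
    {κ : ZpExtension ℚ p} {γ : Field.absoluteGaloisGroup ℚ} {N : ℕ} [NeZero N]
    {f : CuspForm (Gamma0 N) 2}
    (hp1 : p % 4 = 1) (hK2 : Module.finrank ℚ K = 2)
    (hθ : ∃ θ : K, θ ^ 2 = algebraMap ℚ K ((-1) ^ (p / 2) * p)) (hord : IsOrdinaryAt V p)
    (hκ : κ.IsCyclotomic) (hγ : κ.IsTopGenerator γ) (hcv : IsCyclotomicVariable p γ)
    (hγK : γ ∈ galRange (K := ℚ) K) (hγF : γ ∈ galRange (K := ℚ) F) (hf : IsNewformOf V f)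
    (D : ChiEigenSelmerInDualData V K κ (galRange (K := ℚ) F) γ) (ϖ : ℚ)
    (hϖ : (ϖ : ℝ) * V.realPeriodRat = plusPeriod f)
    {g : IwasawaAlgebra p}
    (hg : g ∈ Literature.NumberTheory.EllipticCurves.Module.charIdeal (IwasawaAlgebra p) D.X) :
    ∃ h : ℤ_[p], ((PowerSeries.constantCoeff g : ℤ_[p]) : ℚ_[p]) =
      (h : ℚ_[p]) * (ϖ : ℚ_[p]) * (legendrePlusSymbolSum f p : ℚ_[p]) := by
  have hp2 : p ≠ 2 := by rintro rfl; norm_num at hp1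
  have heven : Even (p / 2) := ⟨p / 4, by omega⟩
  obtain ⟨h, hιg⟩ := hc K F (κ := κ) (γ := γ) (f := f)
    (padicLFunctionBranch f ((unitRoot V p : ℤ_[p]) : ℚ_[p]) (p / 2)) hp2 hK2 hθ
    (Or.inl ⟨hord, by rw [if_pos heven]⟩) hκ hγ hcv hγK hγF hf D ϖ (by rw [if_pos heven]; exact hϖ)
    g hg
  obtain ⟨-, hunit⟩ := unitRoot_spec_holds V p hord
  obtain ⟨ua, hua⟩ := hunit
  refine ⟨PowerSeries.constantCoeff h * (ua⁻¹ : ℤ_[p]ˣ), ?_⟩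
  have h0 := congrArg PowerSeries.constantCoeff hιg
  rw [constantCoeff_iwasawaToPowerSeries, map_mul, map_mul, constantCoeff_iwasawaToPowerSeries,
    PowerSeries.constantCoeff_C, constantCoeff_padicLFunctionBranch_half p hp2 V hord hf, ← hua] at h0
  rw [h0, PadicInt.coe_mul, coe_units_inv_eq_inv]
  ring

/-- **`T = 0` under the conjecture, good ordinary `E♭`, ODD branch (`p ≡ 3 (mod 4)`, `p = 3`
included):** every `g ∈ char_Λ e_{(p−1)/2}X` has `g(0) = h · ϖ⁻ · ∑_{a mod p} (a/p)[a/p]⁻_f`,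
`h ∈ ℤ_p` (tree `constantCoeff_padicLFunctionMinusBranch_half`).
[cite: MazurTateTeitelbaum1986Invent, §I.13–I.14]
[cite: Delbourgo1998, Main Conjecture (p. 151) (shape only; nothing asserted)] -/
theorem QuadraticBranchLower.constantCoeff_of_goodOrd_odd
    (hc : QuadraticBranchLowerDivisibilityAt V p)
    (K : Type) [Field K] [NumberField K] [(galRange (K := ℚ) K).Normal]
    (F : Type) [Field F] [NumberField F] [IsCyclotomicExtension {p} ℚ F]
    [(galRange (K := ℚ) F).Normal]
    {κ : ZpExtension ℚ p} {γ : Field.absoluteGaloisGroup ℚ} {N : ℕ} [NeZero N]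
    {f : CuspForm (Gamma0 N) 2}
    (hp3 : p % 4 = 3) (hK2 : Module.finrank ℚ K = 2)
    (hθ : ∃ θ : K, θ ^ 2 = algebraMap ℚ K ((-1) ^ (p / 2) * p)) (hord : IsOrdinaryAt V p)
    (hκ : κ.IsCyclotomic) (hγ : κ.IsTopGenerator γ) (hcv : IsCyclotomicVariable p γ)
    (hγK : γ ∈ galRange (K := ℚ) K) (hγF : γ ∈ galRange (K := ℚ) F) (hf : IsNewformOf V f)
    (D : ChiEigenSelmerInDualData V K κ (galRange (K := ℚ) F) γ) (ϖ : ℚ)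
    (hϖ : (ϖ : ℝ) * V.imaginaryPeriodRat = minusPeriod f)
    {g : IwasawaAlgebra p}
    (hg : g ∈ Literature.NumberTheory.EllipticCurves.Module.charIdeal (IwasawaAlgebra p) D.X) :
    ∃ h : ℤ_[p], ((PowerSeries.constantCoeff g : ℤ_[p]) : ℚ_[p]) =
      (h : ℚ_[p]) * (ϖ : ℚ_[p]) * (legendreMinusSymbolSum f p : ℚ_[p]) := by
  have hp2 : p ≠ 2 := by rintro rfl; norm_num at hp3
  have hodd : ¬ Even (p / 2) := by rw [Nat.not_even_iff_odd]; exact ⟨p / 4, by omega⟩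
  obtain ⟨h, hιg⟩ := hc K F (κ := κ) (γ := γ) (f := f)
    (padicLFunctionMinusBranch f ((unitRoot V p : ℤ_[p]) : ℚ_[p]) (p / 2)) hp2 hK2 hθ
    (Or.inl ⟨hord, by rw [if_neg hodd]⟩) hκ hγ hcv hγK hγF hf D ϖ (by rw [if_neg hodd]; exact hϖ)
    g hg
  obtain ⟨-, hunit⟩ := unitRoot_spec_holds V p hord
  obtain ⟨ua, hua⟩ := hunit
  refine ⟨PowerSeries.constantCoeff h * (ua⁻¹ : ℤ_[p]ˣ), ?_⟩
  have h0 := congrArg PowerSeries.constantCoeff hιg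
  rw [constantCoeff_iwasawaToPowerSeries, map_mul, map_mul, constantCoeff_iwasawaToPowerSeries,
    PowerSeries.constantCoeff_C, constantCoeff_padicLFunctionMinusBranch_half p hp2 V hord hf, ← hua]
    at h0
  rw [h0, PadicInt.coe_mul, coe_units_inv_eq_inv]
  ring

end ConstantTerm


/-- `ι(C(c)·b) = C(c)·ι(b)` for the inclusion `ι : Λ = ℤ_p⟦T⟧ ↪ ℚ_p⟦T⟧` (coefficientwise; as the
tree's `X2.iwasawaToPowerSeries_C_mul`, restated here to keep the imports inside `Additive/`).
[folklore] -/
theorem iwasawaToPowerSeries_C_mul' {p : ℕ} [Fact p.Prime] (c : ℤ_[p]) (b : IwasawaAlgebra p) :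
    iwasawaToPowerSeries p (PowerSeries.C c * b) =
      PowerSeries.C ((c : ℤ_[p]) : ℚ_[p]) * iwasawaToPowerSeries p b := by
  rw [map_mul, PowerSeries.map_C]
  rfl

/-! ### §3 Both halves: the conjecture ∧ the Kato–Wuthrich fact ⟹ `ϖ·B` GENERATES `char_Λ` -/

section Equality

variable {V : WeierstrassCurve ℚ} [V.IsElliptic] [V.IsGloballyMinimal] {p : ℕ} [hp : Fact p.Prime]

/-- **The main-conjecture EQUALITY on the quadratic component from the two divisibilities.** Under
OUR conjecture (`hc`, lower) and the printed Euler-system divisibility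
`Wuthrich2014.kato_halfEigenCharIdeal_dvd_cyclotomicPrime_of_surjective` (`hK`, upper; needs the
`p`-adic tower `ρ̄_{E♭,p^n}` onto ∀ `n`), for every eigen-`Λ`-dual datum `D`: `D.X` is `Λ`-torsion
and `char_Λ D.X` contains an element `g₀` with `ι g₀ = u·ϖ·B` (`u ∈ ℤ_p^×`) which DIVIDES (in
`ℚ_p⟦T⟧`, by an element of `Λ`) every `g ∈ char_Λ D.X` — i.e. `(ϖ·B) = char_{Λ(Γ)} e_{(p−1)/2}X`
up to `Λ^×`. Pure composition; nothing beyond the two inputs. The Wuthrich/Kato datum type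
`EigenSelmerDualData` and the cell's `ChiEigenSelmerInDualData` are matched field by field by the
caller (`hD`). [cite: Kato2004Asterisque, Thm. 17.4 (3) (p. 273)] [cite: Wuthrich2014, Thm. 16 (p. 397)]
[cite: SkinnerUrban2014, Thm. 3.6.4 (p. 43) (shape only; nothing asserted)] -/
theorem QuadraticBranchLower.exists_generator_of_lower_of_upper
    (hc : QuadraticBranchLowerDivisibilityAt V p)
    (K : Type) [Field K] [NumberField K] [(galRange (K := ℚ) K).Normal]
    (F : Type) [Field F] [NumberField F] [IsCyclotomicExtension {p} ℚ F]
    [(galRange (K := ℚ) F).Normal]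
    {κ : ZpExtension ℚ p} {γ : Field.absoluteGaloisGroup ℚ} {N : ℕ} [NeZero N]
    {f : CuspForm (Gamma0 N) 2} (B : PowerSeries ℚ_[p])
    (hp2 : p ≠ 2) (hK2 : Module.finrank ℚ K = 2)
    (hθ : ∃ θ : K, θ ^ 2 = algebraMap ℚ K ((-1) ^ (p / 2) * p))
    (hB : (IsOrdinaryAt V p ∧
        B = if Even (p / 2) then padicLFunctionBranch f ((unitRoot V p : ℤ_[p]) : ℚ_[p]) (p / 2)
          else padicLFunctionMinusBranch f ((unitRoot V p : ℤ_[p]) : ℚ_[p]) (p / 2)) ∨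
      (V.HasSplitMultiplicativeReductionAtPrime p ∧
        B = if Even (p / 2) then padicLFunctionPlusBranchMult f (1 : ℚ_[p]) (p / 2)
          else padicLFunctionMinusBranchMult f (1 : ℚ_[p]) (p / 2)) ∨
      (V.HasMultiplicativeReductionAtPrime p ∧ ¬ V.HasSplitMultiplicativeReductionAtPrime p ∧
        B = if Even (p / 2) then padicLFunctionPlusBranchMult f (-1 : ℚ_[p]) (p / 2)
          else padicLFunctionMinusBranchMult f (-1 : ℚ_[p]) (p / 2)))
    (hκ : κ.IsCyclotomic) (hγ : κ.IsTopGenerator γ) (hcv : IsCyclotomicVariable p γ)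
    (hγK : γ ∈ galRange (K := ℚ) K) (hγF : γ ∈ galRange (K := ℚ) F) (hf : IsNewformOf V f)
    (D : ChiEigenSelmerInDualData V K κ (galRange (K := ℚ) F) γ) (ϖ : ℚ)
    (hϖ : if Even (p / 2) then (ϖ : ℝ) * V.realPeriodRat = plusPeriod f
      else (ϖ : ℝ) * V.imaginaryPeriodRat = minusPeriod f)
    (hupper : ∃ g₀ ∈ Literature.NumberTheory.EllipticCurves.Module.charIdeal (IwasawaAlgebra p) D.X,
      ∃ u : ℤ_[p]ˣ, iwasawaToPowerSeries p g₀ = PowerSeries.C (((u : ℤ_[p]) : ℚ_[p]) * (ϖ : ℚ_[p])) * B) :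
    ∃ g₀ ∈ Literature.NumberTheory.EllipticCurves.Module.charIdeal (IwasawaAlgebra p) D.X,
      (∃ u : ℤ_[p]ˣ,
        iwasawaToPowerSeries p g₀ = PowerSeries.C (((u : ℤ_[p]) : ℚ_[p]) * (ϖ : ℚ_[p])) * B) ∧
      ∀ g ∈ Literature.NumberTheory.EllipticCurves.Module.charIdeal (IwasawaAlgebra p) D.X,
        ∃ h : IwasawaAlgebra p, iwasawaToPowerSeries p g = iwasawaToPowerSeries p h * iwasawaToPowerSeries p g₀ := by
  obtain ⟨g₀, hg₀, u, hιg₀⟩ := hupper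
  refine ⟨g₀, hg₀, ⟨u, hιg₀⟩, fun g hg ↦ ?_⟩
  obtain ⟨h, hιg⟩ := hc K F (κ := κ) (γ := γ) (f := f) B hp2 hK2 hθ hB hκ hγ hcv hγK hγF hf D ϖ hϖ g hg
  -- `ι g = ι h · ϖ B = ι (h · u⁻¹) · (u ϖ B) = ι (h u⁻¹) · ι g₀`
  refine ⟨PowerSeries.C ((u⁻¹ : ℤ_[p]ˣ) : ℤ_[p]) * h, ?_⟩
  rw [hιg, hιg₀, iwasawaToPowerSeries_C_mul', coe_units_inv_eq_inv]
  have hu0 : (((u : ℤ_[p]) : ℚ_[p])) ≠ 0 := by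
    rw [Ne, PadicInt.coe_eq_zero]
    exact u.ne_zero
  have hϖC : PowerSeries.C (ϖ : ℚ_[p]) =
      PowerSeries.C ((((u : ℤ_[p]) : ℚ_[p]))⁻¹) * PowerSeries.C (((u : ℤ_[p]) : ℚ_[p]) * (ϖ : ℚ_[p])) := by
    rw [← map_mul, ← mul_assoc, inv_mul_cancel₀ hu0, one_mul]
  rw [hϖC]
  ring

end Equality

end Summit.BirchSwinnertonDyer.Rank1Residual.Additive

end
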